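import Mathlib

/-!
# RGFixedPoint — a cascade MACHINE is a fixed point (mod symmetry) of the RENORMALISED LEVEL MAP;
# what power iteration of that map can and cannot show   (FLUID COMPUTER cell, idea-1 gen 10, P-G10-1)

HONEST FRAMING: low prior, high value-of-information experiment on Tao's machine paradigm;
NOT a claim that NS blows up.

Dictionary (cell files `PREREG-R2.md` §10s, `atlas/IDEA-1.md` §14).  On the torus the cell's rung reads ONE
level of a would-be cascade: in-band `[k₀/√λ, k₀√λ)` → out-band one octave up, sup-velocity gain `g`,
level ratio `r = g/λ`, floor `r ≥ 1`.  The optimiser (opt-adj R3 pass 0, 3-engine certified) gives the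
LARGEST one-level gain `g⋆ = 3.2067` on the energy sphere of in-band fields — the top "singular vector" of
the level map — and its own second level fails (`r₂ = 0.19`, peaks in reverse order).  A discretely
self-similar machine is not the optimum of the level map but a FIXED POINT, modulo the symmetries of the
torus, of the RENORMALISED level map
`M = (renormalise energy) ∘ (lattice dilation k ↦ k/λ on the even sublattice) ∘ (out-band projection) ∘ (flow for T)`,
which maps the in-band energy sphere to itself (the even modes of `[5,9)` are exactly `2 × [2.5,4.5)`).
This file types the bookkeeping of that reformulation, over an abstract map; nothing about Navier–Stokes
is asserted:

* `gain_iterate_of_relFixed` — a fixed point modulo a gain-preserving symmetry that commutes with `M`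
  (`M v = σ v`) generates a ladder with the SAME gain at every level; hence
  `floor_all_of_relFixed` (`λ ≤ gain v` ⇒ every level ratio `≥ 1`) and
  `subfloor_all_of_relFixed` (`gain v < λ` ⇒ every level ratio `< 1`);
* `eventually_subfloor_of_tendsto` — if along the power iteration from a seed the gains converge to
  `g∞ < λ`, the seed's ladder is eventually below the floor (an ATTRACTING sub-critical fixed point kills
  every seed in its basin — the typed shape of the lens's negative prediction P-G10-1 (c));
* `gain_iterate_le_of_opt` — every iterate's gain is bounded by the certified optimum IF the optimum is
  global on the manifold (prediction (a): an iterate beating `g⋆` refutes globality, not the bookkeeping);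
* `overlap_floor` — the ENVELOPE inequality: if gains obey a two-mode envelope
  `g² ≤ g⋆² ρ² + g⊥² (1 - ρ²)` in the overlap `ρ` with the optimiser's orbit, a floor step `λ ≤ g` with
  `g⊥ < λ` forces `g⊥ < g⋆` and `ρ² ≥ (λ² - g⊥²)/(g⋆² - g⊥²)`; `overlap_floor_rowA` is the number for the
  cell's pins (`g⋆ = 3.21`, `λ = 2`, `g⊥ = 1.5` ⇒ `ρ ≥ 0.466`).

Nearest prior art (prose): numerical RG / dynamic rescaling iterate "integrate, rescale" to a fixed point for
CONTINUOUSLY self-similar asymptotics (Chen–Goldenfeld; Bricmont–Kupiainen–Lin; Braga–Furtado–Lee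
arXiv:1707.05544; Chen–Hou dynamic rescaling for blow-up profiles); the one-step self-similar TRANSFER
functional of Matharu–Protas–Yoneda (arXiv:2507.12764) and its 3D transplant in this cell
(HOME/code/optadj-selfsim) are phase-blind spectral misfits, not fixed points.  Backward λ-DSS blow-up of
Navier–Stokes is excluded only for λ near 1 (Chae–Wolf arXiv:1610.09464 Thm 1.3); λ = 2 is open.
0 sorry; elementary.  Staged by planner seat pub-fluidc-idea-1 gen 10
(HOME/pub-fluidc-idea-1/lean/RGFixedPoint.lean); intended home
`Summits/NavierStokesRegularity/FluidComputer/RGFixedPoint.lean` (filing is the literature seat's call;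
filed by pub-fluidc-lit gen 38 verbatim up to one docstring added on `LevelMap.lam_pos` for the gate's lint).
-/

noncomputable section

open Filter Topology Function

namespace Summit.NavierStokesRegularity.FluidComputer.RGFixedPoint

/-- An abstract RENORMALISED LEVEL MAP: a self-map `M` of a state space (in the cell: the energy sphere of
in-band fields), the one-level sup-velocity GAIN read on the trajectory started at a state, and the scale
ratio `lam > 1` of the band ladder. -/
structure LevelMap (X : Type*) where
  /-- evolve for the level time, project on the out-band, dilate back to the in-band, renormalise -/
  M : X → X
  /-- one-level band sup-velocity gain of the trajectory started at `v` -/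
  gain : X → ℝ
  /-- scale ratio of consecutive levels -/
  lam : ℝ
  one_lt_lam : 1 < lam

namespace LevelMap

variable {X : Type*} (Φ : LevelMap X)

/-- Gain of level `n` of the ladder generated from the seed `v` by power iteration. -/
def levelGain (v : X) (n : ℕ) : ℝ := Φ.gain (Φ.M^[n] v)

/-- Level ratio `r_n = g_n / λ` of the generated ladder (the rung's currency; floor `r_n ≥ 1`). -/
def levelRatio (v : X) (n : ℕ) : ℝ := Φ.levelGain v n / Φ.lam

/-- The scale ratio is positive. -/
theorem lam_pos : 0 < Φ.lam := lt_trans zero_lt_one Φ.one_lt_lam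

/-- A gain-preserving symmetry stays gain-preserving under iteration. -/
theorem gain_iterate_symm {σ : X → X} (hσ : ∀ w, Φ.gain (σ w) = Φ.gain w) (n : ℕ) (w : X) :
    Φ.gain (σ^[n] w) = Φ.gain w := by
  induction n generalizing w with
  | zero => simp
  | succ n ih => rw [iterate_succ_apply, ih, hσ]

/-- Power iteration from a RELATIVE fixed point `M v = σ v` (fixed modulo a symmetry commuting with `M`)
just moves along the symmetry orbit: `M^[n] v = σ^[n] v`. -/
theorem iterate_of_relFixed {σ : X → X} (hMσ : Function.Commute Φ.M σ) {v : X} (hv : Φ.M v = σ v)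
    (n : ℕ) : Φ.M^[n] v = σ^[n] v := by
  induction n with
  | zero => simp
  | succ n ih =>
      rw [iterate_succ_apply', ih, (hMσ.iterate_right n).eq, hv, ← iterate_succ_apply σ n v]

/-- **A machine is a relative fixed point**: from `M v = σ v` with `σ` gain-preserving and commuting with
`M`, every level of the generated ladder has the seed's gain. -/
theorem gain_iterate_of_relFixed {σ : X → X} (hMσ : Function.Commute Φ.M σ)
    (hσ : ∀ w, Φ.gain (σ w) = Φ.gain w) {v : X} (hv : Φ.M v = σ v) (n : ℕ) :
    Φ.levelGain v n = Φ.gain v := by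
  unfold levelGain
  rw [Φ.iterate_of_relFixed hMσ hv n, Φ.gain_iterate_symm hσ n v]

/-- A super-critical relative fixed point (`λ ≤ gain v`) meets the floor at EVERY level. -/
theorem floor_all_of_relFixed {σ : X → X} (hMσ : Function.Commute Φ.M σ)
    (hσ : ∀ w, Φ.gain (σ w) = Φ.gain w) {v : X} (hv : Φ.M v = σ v) (hsup : Φ.lam ≤ Φ.gain v)
    (n : ℕ) : 1 ≤ Φ.levelRatio v n := by
  unfold levelRatio
  rw [Φ.gain_iterate_of_relFixed hMσ hσ hv n, le_div_iff₀ Φ.lam_pos, one_mul]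
  exact hsup

/-- A sub-critical relative fixed point (`gain v < λ`) is below the floor at every level. -/
theorem subfloor_all_of_relFixed {σ : X → X} (hMσ : Function.Commute Φ.M σ)
    (hσ : ∀ w, Φ.gain (σ w) = Φ.gain w) {v : X} (hv : Φ.M v = σ v) (hsub : Φ.gain v < Φ.lam)
    (n : ℕ) : Φ.levelRatio v n < 1 := by
  unfold levelRatio
  rw [Φ.gain_iterate_of_relFixed hMσ hσ hv n, div_lt_iff₀ Φ.lam_pos, one_mul]
  exact hsub

/-- **Attracting sub-critical behaviour kills the seed**: if the gains along the power iteration from `v`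
converge to `g∞ < λ`, the generated ladder is eventually (and forever after) below the floor. -/
theorem eventually_subfloor_of_tendsto {v : X} {g : ℝ}
    (hlim : Tendsto (fun n => Φ.levelGain v n) atTop (𝓝 g)) (hg : g < Φ.lam) :
    ∀ᶠ n in atTop, Φ.levelRatio v n < 1 := by
  have h : ∀ᶠ n in atTop, Φ.levelGain v n < Φ.lam := hlim (Iio_mem_nhds hg)
  filter_upwards [h] with n hn
  unfold levelRatio
  rw [div_lt_iff₀ Φ.lam_pos, one_mul]
  exact hn

/-- Consequently such a seed does NOT generate a machine (a machine needs `r_n ≥ 1` at all large `n`). -/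
theorem not_floor_frequently_of_tendsto {v : X} {g : ℝ}
    (hlim : Tendsto (fun n => Φ.levelGain v n) atTop (𝓝 g)) (hg : g < Φ.lam) :
    ¬ (∃ᶠ n in atTop, 1 ≤ Φ.levelRatio v n) := by
  rw [Filter.not_frequently]
  filter_upwards [Φ.eventually_subfloor_of_tendsto hlim hg] with n hn
  exact not_le.mpr hn

/-- **Consistency with the certified optimum**: if `g⋆` bounds the gain of EVERY state of the manifold
(the optimum is global and `M` maps the manifold to itself), it bounds every iterate.  An iterate beating
`g⋆` therefore refutes the globality hypothesis — prediction P-G10-1 (a). -/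
theorem gain_iterate_le_of_opt {gstar : ℝ} (hopt : ∀ w, Φ.gain w ≤ gstar) (v : X) (n : ℕ) :
    Φ.levelGain v n ≤ gstar := hopt _

end LevelMap

/-! ## The envelope inequality: how much of the optimiser's gadget a floor step must keep -/

/-- **Overlap floor.**  Two-mode envelope: the gain of a state with overlap `ρ ∈ [0,1]` to the optimiser's
orbit is at most `√(g⋆² ρ² + g⊥² (1 - ρ²))`, where `g⊥` bounds the gain orthogonally to the orbit.  If
`g⊥ < λ`, a floor step `λ ≤ g` forces `g⊥ < g⋆` and `ρ² ≥ (λ² - g⊥²)/(g⋆² - g⊥²)`. -/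
theorem overlap_floor {g gstar gperp lam ρ : ℝ} (hρ0 : 0 ≤ ρ) (hρ1 : ρ ≤ 1) (hlam : 0 < lam)
    (hgp0 : 0 ≤ gperp) (hgp : gperp < lam) (hgs0 : 0 ≤ gstar) (hfloor : lam ≤ g)
    (henv : g ^ 2 ≤ gstar ^ 2 * ρ ^ 2 + gperp ^ 2 * (1 - ρ ^ 2)) :
    gperp < gstar ∧ (lam ^ 2 - gperp ^ 2) / (gstar ^ 2 - gperp ^ 2) ≤ ρ ^ 2 := by
  have hρ2 : ρ ^ 2 ≤ 1 := by nlinarith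
  have hρ20 : 0 ≤ ρ ^ 2 := sq_nonneg ρ
  have hlam2 : lam ^ 2 ≤ g ^ 2 := by nlinarith
  have hgp2 : gperp ^ 2 < lam ^ 2 := by nlinarith
  -- first: g⊥ < g⋆ (else the envelope caps g below λ)
  have hlt : gperp < gstar := by
    by_cases hle : gstar ≤ gperp
    · exfalso
      have : gstar ^ 2 ≤ gperp ^ 2 := by nlinarith
      have : g ^ 2 ≤ gperp ^ 2 := by nlinarith
      nlinarith
    · exact lt_of_not_ge hle
  refine ⟨hlt, ?_⟩
  have hden : 0 < gstar ^ 2 - gperp ^ 2 := by nlinarith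
  rw [div_le_iff₀ hden]
  nlinarith

/-- The number for the cell's row-(a) pins: `g⋆ = 3.21` (certified 3.2067, rounded up), `λ = 2`,
`g⊥ = 1.5` ⇒ a floor step needs overlap `ρ² ≥ 0.2172`, i.e. `ρ ≥ 0.466`. -/
theorem overlap_floor_rowA :
    (0.2172 : ℝ) ≤ ((2 : ℝ) ^ 2 - (1.5 : ℝ) ^ 2) / ((3.21 : ℝ) ^ 2 - (1.5 : ℝ) ^ 2) ∧
      (0.466 : ℝ) ^ 2 ≤ 0.2172 := by
  constructor <;> norm_num

end Summit.NavierStokesRegularity.FluidComputer.RGFixedPoint
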